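import Summits.AnomalousDissipation.AnomalousDissipation.Theorems.MarginalStabilityChainStrainedLayerLawClockReduction
import HarnessLib

/-!
# Crux `MarginalStabilityChain.StrainedLayerLaw` (stmt-AnomalousDissipation-3007), line `FirstLemmasR2K4`
# (log-enstrophy clock + Nash roundness): the clock composition PER MEMBER

Support file (`--supports stmt-AnomalousDissipation-3007`; registered sub-goal
`meanLayerDissipation_floor_of_eventuallyRound` of line `FirstLemmasR2K4`, lead c6, wave 1).

What it proves: for ONE classical solution `(u, v, p)` of the stretched layer class on `(0, ∞)` (viscosity `ν > 0`,
period `L > 0`) with shear tails on every compact time interval `[a, b] ⊂ (0, ∞)` and EVENTUAL Nash roundness of the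
negative vorticity with constant `r₀ > 0` (`r₀ M₋² P₋ ≤ Ω₋²` for `t ≥ T₁`), the long-time mean dissipation obeys
`ofReal (r₀ L / 4) ≤ meanLayerDissipation ν L u v`. This is the landed conditional composition
`StrainedLayerLaw_of_clockStubs` (`…ClockComposition.lean`) run inside ONE member, with its stub hypotheses replaced by
the landed theorems: `clock_negEnstrophy_pos_and_bounded` (positivity of `Ω₋` for `t > 0`, bound `Ω₋ ≤ B` for `t ≥ 1`),
`stub_negEnstrophyLaw stub_levelSetNull` (`Ω₋′ = Ω₋ − 2νP₋`), `stub_circulationFloor` (`M₋ ≥ L`), then `clockTransfer`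
(`(r₀L²/2 − ε)T ≤ ∫_{t₀+1}^T νΩ₋` eventually, `t₀ = max T₁ 1`), `ofReal_negEnstrophy_le` (`ofReal (νΩ₋) ≤ 2·(ofReal L·D)`)
and `floorTransfer_direct` (Cesàro step in `ℝ≥0∞`, `K = r₀L/4`, `L·K = r₀L²/4`). No facts are asserted.
-/

-- `Summit.<Summit>.<Problem>` is the tree's mandated summit-side namespace (CONVENTIONS §2); for this
-- single-conjunct summit the two coincide, so the duplicate is deliberate.
set_option linter.dupNamespace false

noncomputable section

open scoped Topology ENNReal
open Filter Set Function MeasureTheory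

namespace Summit.AnomalousDissipation.AnomalousDissipation.Theorems.StrainedLayerLaw.LogEnstrophyClock

open Literature.Analysis.FluidPDE Literature.Analysis.FluidPDE.StretchedLayer
open Literature.Analysis.UnboundedOperators
open Summit.AnomalousDissipation.AnomalousDissipation.Theses.MarginalStabilityChain
open Summit.AnomalousDissipation.AnomalousDissipation.Theorems.StrainedLayerLaw.StrainWorkSumRule

/-- **The clock composition per member (registered sub-goal of line `FirstLemmasR2K4`).** For one classical solution
of the stretched layer class on `(0, ∞)` with shear tails on every `[a, b] ⊂ (0, ∞)` and eventual Nash roundness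
`r₀ M₋² P₋ ≤ Ω₋²` (`t ≥ T₁`), the mean dissipation is at least `ofReal (r₀ L / 4)`: `floorTransfer_direct` with
`K = r₀L/4`, fed by `clockTransfer` on `(max T₁ 1, ∞)` (derivative law `stub_negEnstrophyLaw stub_levelSetNull`,
positivity/bound `clock_negEnstrophy_pos_and_bounded`, circulation floor `stub_circulationFloor`) and the pointwise
control `ofReal_negEnstrophy_le`. Proof verbatim from `StrainedLayerLaw_of_clockStubs`. [folklore] -/
theorem meanLayerDissipation_floor_of_eventuallyRound :
    ∀ (ν L r₀ : ℝ), 0 < ν → 0 < L → 0 < r₀ → ∀ (u v p : ℝ → ℝ → ℝ → ℝ),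
      IsStretchedLayerNSSolutionOn (Ioi 0) ν 1 1 L u v p →
      (∀ a b : ℝ, 0 < a → a < b → ExpTails (Icc a b) u v) →
      (∃ T₁ : ℝ, 0 < T₁ ∧ ∀ t : ℝ, T₁ ≤ t →
        r₀ * negMass L (u t) (v t) ^ 2 * negPalinstrophy L (u t) (v t) ≤ negEnstrophy L (u t) (v t) ^ 2) →
        ENNReal.ofReal (r₀ * L / 4) ≤ meanLayerDissipation ν L u v := by
  intro ν L r₀ hν hL hr₀ u v p hsol htails hR
  obtain ⟨T₁, hT₁, hround⟩ := hR
  rw [meanLayerDissipation_def]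
  refine floorTransfer_direct L (r₀ * L / 4) (fun t => layerDissipation ν L (u t) (v t)) hL ?_
  intro _ ε hε
  obtain ⟨hpos, B, hB⟩ := clock_negEnstrophy_pos_and_bounded hν hL hsol htails
  have hderiv := stub_negEnstrophyLaw stub_levelSetNull ν L hν hL u v p hsol htails
  -- notation for the three functionals along the solution
  set Ω : ℝ → ℝ := fun t => negEnstrophy L (u t) (v t) with hΩdef
  set P : ℝ → ℝ := fun t => negPalinstrophy L (u t) (v t) with hPdef
  set M : ℝ → ℝ := fun t => negMass L (u t) (v t) with hMdef
  set t₀ : ℝ := max T₁ 1 with ht₀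
  have ht₀T : T₁ ≤ t₀ := le_max_left _ _
  have ht₀1 : (1 : ℝ) ≤ t₀ := le_max_right _ _
  have ht₀pos : 0 < t₀ := one_pos.trans_le ht₀1
  -- the circulation floor along the solution (tails on `[t, t + 1]`)
  have hMfloor : ∀ t, 0 < t → L ≤ M t := by
    intro t ht
    obtain ⟨C, k, hk, hCk⟩ := htails t (t + 1) ht (lt_add_one t)
    have hST : SliceTails C k (u t) (v t) := (hCk t ⟨le_rfl, (lt_add_one t).le⟩).1
    have ht' : t ∈ Ioi (0 : ℝ) := ht
    exact stub_circulationFloor L C k hL hk (u t) (v t) (hsol.contDiff_u ht') (hsol.contDiff_v ht')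
      (hsol.periodic_u t ht') (hsol.periodic_v t ht') (by simpa using hsol.tendsto_u_atTop t ht')
      (by simpa using hsol.tendsto_u_atBot t ht') hST
  -- the clock
  have hclock := clockTransfer (ν := ν) (L := L) (r₀ := r₀) (t₀ := t₀) (C := B) (Ω := Ω) (P := P) (M := M)
    hν hL hr₀
    (fun t ht => hderiv t (ht₀pos.trans ht))
    (fun t ht => hpos t (ht₀pos.trans ht))
    (fun t ht => hB t (ht₀1.trans ht.le))
    (fun t _ => negPalinstrophy_nonneg L (u t) (v t))
    (fun t ht => hMfloor t (ht₀pos.trans ht))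
    (fun t ht => hround t (ht₀T.trans ht.le))
  -- continuity of `Ω` on `(0, ∞)` (from the derivative)
  have hΩcont : ContinuousOn Ω (Ioi 0) := fun t ht => (hderiv t ht).continuousAt.continuousWithinAt
  filter_upwards [hclock ε hε, eventually_ge_atTop (t₀ + 1)] with T hT hTge
  -- (1) the real floor in `ℝ≥0∞`: `ofReal (2 (LK − ε) T) ≤ ofReal (∫_{t₀+1}^T νΩ)`
  have hKL : L * (r₀ * L / 4) = r₀ * L ^ 2 / 4 := by ring
  have hT0 : 0 ≤ T := by linarith
  have hstep1 : ENNReal.ofReal (2 * ((L * (r₀ * L / 4) - ε) * T)) ≤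
      ENNReal.ofReal (∫ t in (t₀ + 1)..T, ν * Ω t) := by
    apply ENNReal.ofReal_le_ofReal
    have : 2 * ((L * (r₀ * L / 4) - ε) * T) ≤ (r₀ * L ^ 2 / 2 - ε) * T := by
      rw [hKL]; nlinarith
    exact this.trans hT
  -- (2) the interval integral as a set `lintegral`
  have hint : IntegrableOn (fun t => ν * Ω t) (Ioc (t₀ + 1) T) := by
    have hc : ContinuousOn (fun t => ν * Ω t) (Icc (t₀ + 1) T) :=
      (continuousOn_const.mul (hΩcont.mono fun t ht => ht₀pos.trans (by linarith [ht.1])))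
    exact (hc.integrableOn_compact isCompact_Icc).mono_set Ioc_subset_Icc_self
  have hstep2 : ENNReal.ofReal (∫ t in (t₀ + 1)..T, ν * Ω t) =
      ∫⁻ t in Ioc (t₀ + 1) T, ENNReal.ofReal (ν * Ω t) := by
    rw [intervalIntegral.integral_of_le hTge]
    exact ofReal_integral_eq_lintegral_ofReal hint
      (ae_of_all _ fun t => mul_nonneg hν.le (negEnstrophy_nonneg L (u t) (v t)))
  -- (3) enlarge the time set and use the pointwise control by the dissipation
  have hstep3 : ∫⁻ t in Ioc (t₀ + 1) T, ENNReal.ofReal (ν * Ω t) ≤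
      ∫⁻ t in Ioc 1 T, ENNReal.ofReal (ν * Ω t) :=
    lintegral_mono_set (Ioc_subset_Ioc_left (by linarith))
  have hstep4 : ∫⁻ t in Ioc 1 T, ENNReal.ofReal (ν * Ω t) ≤
      2 * (ENNReal.ofReal L * ∫⁻ t in Ioc 1 T, layerDissipation ν L (u t) (v t)) := by
    calc ∫⁻ t in Ioc 1 T, ENNReal.ofReal (ν * Ω t)
        ≤ ∫⁻ t in Ioc 1 T, 2 * (ENNReal.ofReal L * layerDissipation ν L (u t) (v t)) :=
          lintegral_mono fun t => ofReal_negEnstrophy_le hν.le hL (u t) (v t)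
      _ = 2 * (ENNReal.ofReal L * ∫⁻ t in Ioc 1 T, layerDissipation ν L (u t) (v t)) := by
          rw [lintegral_const_mul' _ _ ENNReal.ofNat_ne_top, lintegral_const_mul' _ _ ENNReal.ofReal_ne_top]
  -- (4) assemble and divide by two
  have hall : 2 * ENNReal.ofReal ((L * (r₀ * L / 4) - ε) * T) ≤
      2 * (ENNReal.ofReal L * ∫⁻ t in Ioc 1 T, layerDissipation ν L (u t) (v t)) := by
    calc 2 * ENNReal.ofReal ((L * (r₀ * L / 4) - ε) * T)
        = ENNReal.ofReal (2 * ((L * (r₀ * L / 4) - ε) * T)) := by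
          rw [ENNReal.ofReal_mul zero_le_two, ENNReal.ofReal_ofNat]
      _ ≤ ENNReal.ofReal (∫ t in (t₀ + 1)..T, ν * Ω t) := hstep1
      _ = ∫⁻ t in Ioc (t₀ + 1) T, ENNReal.ofReal (ν * Ω t) := hstep2
      _ ≤ ∫⁻ t in Ioc 1 T, ENNReal.ofReal (ν * Ω t) := hstep3
      _ ≤ 2 * (ENNReal.ofReal L * ∫⁻ t in Ioc 1 T, layerDissipation ν L (u t) (v t)) := hstep4
  exact (ENNReal.mul_le_mul_iff_right two_ne_zero ENNReal.ofNat_ne_top).1 hall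

end Summit.AnomalousDissipation.AnomalousDissipation.Theorems.StrainedLayerLaw.LogEnstrophyClock

end
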